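import Summits.HubbardSuperconductivity.HubbardSuperconductivity.Theses.ColourTheSpin
import HarnessLib

/-!
# Crux `SgCorridor` (stmt-HubbardSuperconductivity-16274; route `ColourTheSpin`, rank 4, "corridor
transfer") — BIRTH SKELETON `Lines/birth.lean` (BC3)

THE CRUX (fixed; `Theses/ColourTheSpin.lean`, decl `SgCorridor := SgAnchorOrder → SgCorridorOrder`,
not restated here). `SgAnchorOrder`: at some `U > 0`, `δ ∈ (0,1/2)`, for all STRONG gauge couplings
`g ≥ g₀` and all large even `L`, every ground state `ψ` of the `N_L = 2⌊(1-δ)L²/2⌋`-particle block of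
the Q8-spin-gauged Hubbard torus `H_g(L,U)` (electrons `(t = 1, U, N_L)` of the summit verbatim, spin
minimally coupled to a `Q8 ⊂ SU(2)` link field with electric weight `g² Σ_b E_b` and magnetic weight
`g⁻² Σ_p (1 - ½ tr ρ(hol_p))`, all Gauss sectors admitted) has gauged `B1g` singlet pair order
`c·L⁴·‖ψ‖² ≤ ⟨ψ, Δ_d^g† Δ_d^g ψ⟩`. `SgCorridorOrder`: the same order, with one constant `c′ > 0`, for
all `g ∈ (0, g₀′]` for some `g₀′ > 0` (order in a punctured neighbourhood of the endpoint `g = 0⁺`,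
uniformly). The crux transfers the order from the strong-coupling half-line to the endpoint corridor.

THE LINE = the crux's own stated content cut at its one natural joint, the distinction between the
REGULAR couplings `g > 0` (where `g ↦ H_g = A + g²·B + g⁻²·C` is a real-analytic self-adjoint family)
and the SINGULAR endpoint `g → 0⁺` (where the magnetic weight `g⁻²` diverges and the links freeze to
flat `Q8` connections). The route header's foreseen split `SgStrongSide (g ≥ 1) → SgWeakSide (g ≤ 1)`
is NOT used: the pivot `g = 1` cannot honestly be labelled "confined"/"deconfined" (the finite-group
deconfinement scale of `H_g` with dynamical electrons is unknown even numerically), whereas the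
regular/singular joint is intrinsic. Both pieces are typed ON THE Q8-GAUGED FAMILY (vocabulary
`OrderAt`, verbatim the common matrix of `SgAnchorOrder`/`SgCorridorOrder`/`SgEndpoint`), pointwise
in `(U, δ)` (the crux is an implication between ∃-items, so any proof must treat an arbitrary anchor
witness anyway), because the MODEL-FREE shape "every-ground-state order at one coupling ⇒ at another"
is false by level crossing (landed sibling negative lemma
`Summit.HubbardSuperconductivity.TwTipContinuation.Negative.not_abstractTipShape`, 2×2 witness) and the
abstract "order is open under small covariant perturbations" is refuted in the negatives index
(stmt-HubbardSuperconductivity-1314 `KlsOrderOpenness`): a proof of either stub must use the structure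
of `H_g` (gauge invariance of `Δ_d^g`, Elitzur, the electric gap, the flat-connection reduction).

1. `stub_halfLinePersistence` — PERSISTENCE TO EVERY POSITIVE FLOOR (the bet of the crux: no loss of
   pair order at any regular coupling, in particular across the confinement–deconfinement crossing of
   the finite gauge group). For all `U > 0`, `δ ∈ (0,1/2)`, `g₀ > 0`, `c > 0`, `L₀`: if every ground
   state of the `N_L`-block of `H_g(L,U)` has order `≥ c L⁴‖ψ‖²` for all `g ≥ g₀` and all even
   `L ≥ L₀` (the anchor matrix at `(U,δ)`, verbatim), then for EVERY floor `g₁ > 0` there are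
   `c₁ > 0`, `L₁` with the same order bound for all `g ≥ g₁`, even `L ≥ L₁` (`HalfLineOrder U δ`).
   Content: on the strong side Osterwalder–Seiler/Fradkin–Shenker-type continuity of the confined
   regime (convergent strong-coupling cluster expansion in `t/g²`, `g⁻⁴`, lifted from the vacuum to the
   pair two-point function of the `N_L`-block ground states); on the weak side stability of the
   electrons' LOCAL gauge-invariant singlet pair order through the `Q8` quantum-double (deconfinement)
   transition of the link field, below which the gauge sector is a gapped `D(Q8)` topological phase
   (Kitaev 2003; stability of topological order under local perturbations, Bravyi–Hastings–Michalakis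
   2010) weakly dressing the electrons. Why it might fail = the crux's: a finite gauge group
   deconfines at small `g` in 2+1 D; spinful quasiparticles and spin-competitor precursors return
   below `g_c` and the pair order can vanish on an intermediate window or jump to zero at a first-order
   transition (Z₂-gauged fermions: Borla–Verresen–Jian–Vishwanath–Moroz 2022, Gazit–Randeria–Vishwanath
   2017, Assaad–Grover 2016 — pairing is confinement-induced there and absent in the deconfined phase
   of FREE fermions; here the deconfined end is the REPULSIVE Hubbard model, whose `d`-wave order is the
   route's bet). Size: crux-sized (the residual of the crux at regular couplings).
2. `stub_zeroCouplingFloor` — A FLOOR FOR `c′` AT THE SINGULAR ENDPOINT `g → 0⁺` ("nothing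
   quantitative floors c′" made a statement). For all `U > 0`, `δ ∈ (0,1/2)`: order on every half-line
   `[g₁, ∞)` with floor-dependent constants (`HalfLineOrder U δ`) implies order with ONE constant on a
   whole corridor `(0, g₀′]` (`CorridorOrderAt U δ`, verbatim the matrix of `SgCorridorOrder` at
   `(U,δ)`), i.e. `inf_{g ∈ (0,g₀′]} c(g) > 0` and `sup L(g) < ∞`: the constants do not degenerate at
   the endpoint. Content: singular (Born–Oppenheimer) reduction as `g → 0⁺` — the magnetic weight
   `g⁻² Σ_p (1 - ½ tr ρ(hol_p))` has gap `≥ g⁻²` above the FLAT `Q8` connections (finite group: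
   flatness is an equation), so every ground state of the `N_L`-block concentrates on
   (fermions) ⊗ (flat links) up to `O(g²·‖t‖)`, where the reduced problem is a finite direct sum of
   `Q8`-spin-twisted Hubbard tori mixed at order `g²` by the electric term (degenerate perturbation
   theory, Kato 1966 II-§2; Datta–Fernández–Fröhlich 1996); the order constant `c(g)` is then
   lower-semicontinuous at `0⁺` with limit the order constant of the SELECTED reduced ground states,
   which by the hypothesis at small `g₁` … is exactly what must be shown not to vanish. Why it might
   fail: order present at every `g > 0` but generated by the gauge fluctuations themselves
   (`⟨Δ†Δ⟩/L⁴ ~ f(g) → 0` as `g → 0⁺`: a deconfined `Q8` field mediates an `O(g²)` spin interaction)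
   at a `(U,δ)` where the reduced (twisted-Hubbard) ground states have no `B1g` order; and the
   `L`-threshold `L(g)` may diverge as `g → 0⁺` (the reduction needs `g⁻² ≫` the `L`-dependent
   density of fermionic states). Size: L (a singular-perturbation theorem for a gapless fermion block;
   no tool in tree).

COMPOSITION. `corridorOrder_of_pieces : Sig.stub_halfLinePersistence → Sig.stub_zeroCouplingFloor →
SgAnchorOrder → SgCorridorOrder` (pure logic over the bookkeeping identities `sgAnchorOrder_iff`,
`sgCorridorOrder_iff`, both `Iff.rfl`: the route items ARE the prefixed `OrderAt` statements), hence
`SgCorridor_of : Sig.stub_halfLinePersistence → Sig.stub_zeroCouplingFloor → SgCorridor` and the A12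
shape `SgCorridor_proof : SgCorridor := SgCorridor_of stub_halfLinePersistence stub_zeroCouplingFloor`
(concludes the route decl BY NAME; the only `sorry`s are inside the two `stub_*`).

DISPROOF USED: no `Cruxes/SgCorridor/Disproof.lean`, no `Theorems/SgCorridor/Negative/` (2026-08-17,
`ledger crux ls stmt-HubbardSuperconductivity-16274`: no workfiles). Honoured: sibling
`TwTipContinuation.Negative.not_abstractTipShape` / `UniformRungsShapeFalse` (abstract continuation
shapes are false ⇒ both stubs model-typed); negatives index (2 entries: stmt-1180 `BreathingSelfDual`,
stmt-1314 `KlsOrderOpenness`) — neither stub is an instance (both are statements about the one family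
`H_g`, not about a class of perturbations).

BC3 AUDIT (planner folder `bc/`, farm `lean check --json`, 2026-08-17): this file rc 0, errors 0,
`sorries = 2` = the two stubs (warnings only `declaration uses sorry` at `stub_halfLinePersistence`,
`stub_zeroCouplingFloor`; zero elsewhere; advisory file audit: `SgCorridor_proof` proof-of-item for
`ColourTheSpin.SgCorridor`, NOT closed: axioms [sorryAx]). PROBES (hypothesis = the stub signature
verbatim over this vocabulary, this file's theorems NOT in scope, `maxHeartbeats 400000` each):
`stub → SgCorridor` and `stub → HubbardSuperconductivity` for both stubs, each by the seven variants
`first | exact? | simpa | aesop`, `exact?`, `simpa`, `simpa [defs]`, `unfold …; simpa`, `aesop`,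
`intro; unfold …; aesop` — 28/28 FAIL ("exact? could not close the goal" / "assumption failed" /
"aesop: failed to prove the goal after exhaustive search" ⊢ SgCorridor, ⊢ HubbardSuperconductivity /
two whnf heartbeat time-outs and one maxRecDepth in the `simpa [defs]`/`unfold` variants on the
inlined matrix). Positive controls pass: `sig → sig` by `aesop` and `simpa` (both stubs) and by
`exact?` (stub 2; for stub 1 `exact?` cannot even re-derive `sig → sig` — solve_by_elim depth — so its
probe failures are uninformative there and the `aesop`/`simp` ones carry the verdict); `exact?` does
find modus ponens `SgAnchorOrder → SgCorridor → SgCorridorOrder` and the route's `closes`. No stub is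
cheaply the crux or the summit.

Sources: E. Fradkin, S. H. Shenker, PRD 19 (1979) 3682 (doi:10.1103/physrevd.19.3682); K. Osterwalder,
E. Seiler, Ann. Phys. 110 (1978) 440 (doi:10.1016/0003-4916(78)90039-8); J. Kogut, L. Susskind, PRD 11
(1975) 395 (doi:10.1103/physrevd.11.395); S. Elitzur, PRD 12 (1975) 3978; A. Kitaev, Ann. Phys. 303
(2003) 2 (doi:10.1016/S0003-4916(02)00018-0); S. Bravyi, M. Hastings, S. Michalakis, J. Math. Phys. 51
(2010) 093512 (doi:10.1063/1.3490195); U. Borla, B. Jeevanesan, F. Pollmann, S. Moroz, PRB 105 (2022)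
075132 (doi:10.1103/physrevb.105.075132); S. Gazit, M. Randeria, A. Vishwanath, Nat. Phys. 13 (2017)
484 (doi:10.1038/nphys4028); F. F. Assaad, T. Grover, PRX 6 (2016) 041049
(doi:10.1103/physrevx.6.041049); T. Kato, Perturbation Theory for Linear Operators (1966) II-§2,
VII-§3; N. Datta, R. Fernández, J. Fröhlich, J. Stat. Phys. 84 (1996) 455 (doi:10.1007/BF02179651).
No Literature definition is introduced; the `def`s below are local vocabulary whose bodies are
VERBATIM the route file's inlined matrix.
-/

noncomputable section

-- `dupNamespace`: the summit and the problem are both named `HubbardSuperconductivity` (layout D-0022)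
set_option linter.dupNamespace false

namespace Summit.HubbardSuperconductivity.HubbardSuperconductivity.Cruxes.SgCorridor.Birth

open scoped Matrix ComplexOrder
open Literature.Probability.LatticeModels Literature.MathematicalPhysics.QuantumLattice
open Summit.HubbardSuperconductivity.HubbardSuperconductivity.Theses.ColourTheSpin
  (SgCorridor SgAnchorOrder SgCorridorOrder)

/-! ### Vocabulary (plain `def`s over existing declarations; the matrix is VERBATIM the route file's) -/

/-- `OrderAt U δ g c L₀` — EVENTUAL EVERY-GROUND-STATE GAUGED `B1g` PAIR ORDER at on-site repulsion `U`,
hole doping `δ`, gauge coupling `g`, with constant `c`, from side `L₀` on: for every even `L ≥ L₀`,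
every ground state `ψ` of the `N_L = 2⌊(1-δ)L²/2⌋`-particle block of the Q8-spin-gauged Hubbard torus
`H_g(L,U)` (all Gauss sectors; ground state = nonzero eigenvector whose eigenvalue lies below every
Rayleigh quotient of the block) satisfies `c·L⁴·‖ψ‖² ≤ Re⟨ψ, Δ_d^g† Δ_d^g ψ⟩`. The `let`-block
(`m, iv` = multiplication/inverse of `Q8` coded on `Fin 2 × ZMod 4`; `r` = its spin-½ representation;
`hop, H` = the gauged Hamiltonian; `P` = the gauge-invariant `B1g` singlet pair field; `p` = the
particle-number constraint) is character-for-character the common matrix of the route items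
`SgAnchorOrder`, `SgCorridorOrder` and of the hypothesis of `SgEndpoint` (`Theses/ColourTheSpin.lean`),
so that those items are `Iff.rfl`-equal to prefixed `OrderAt` statements (`sgAnchorOrder_iff`,
`sgCorridorOrder_iff`). Kogut–Susskind 1975 (group-element link basis); Scalapino 1995 §2 (the order
functional). -/
def OrderAt (U δ g c : ℝ) (L₀ : ℕ) : Prop :=
  ∀ (L : ℕ) [NeZero L], L₀ ≤ L → Even L →
      (let m : Fin 2 × ZMod 4 → Fin 2 × ZMod 4 → Fin 2 × ZMod 4 := fun u v => (u.1 + v.1, if u.1 = 0 then (if v.1 = 0 then u.2 + v.2 else v.2 - u.2) else if v.1 = 0 then u.2 + v.2 else 2 + v.2 - u.2);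
        let iv : Fin 2 × ZMod 4 → Fin 2 × ZMod 4 := fun u => (u.1, if u.1 = 0 then -u.2 else u.2 + 2);
        let r : Fin 2 × ZMod 4 → Fin 2 → Fin 2 → ℂ := fun u σ τ => if u.1 = 0 then (if σ = τ then (if σ = 0 then Complex.I else -Complex.I) ^ u.2.val else 0)
          else if σ = τ then 0 else if σ = 0 then -(-Complex.I) ^ u.2.val else Complex.I ^ u.2.val;
        let hop := ∑ b : GaugedHubbard.Bond L, ∑ σ : Fin 2, ∑ τ : Fin 2, Matrix.kroneckerMap (· * ·) (creation (orb b.1 σ) * annihilation (orb (b.1.shift b.2) τ))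
            (Matrix.diagonal fun k : GaugedHubbard.Bond L → Fin 2 × ZMod 4 => r (k b) σ τ);
        let H := -(hop + hopᴴ)
            + ((U : ℝ) : ℂ) • Matrix.kroneckerMap (· * ·) (∑ x : FermionTorus 2 L, numberOp x 0 * numberOp x 1) (1 : Matrix (GaugedHubbard.Bond L → Fin 2 × ZMod 4) (GaugedHubbard.Bond L → Fin 2 × ZMod 4) ℂ)
            + ((g ^ 2 : ℝ) : ℂ) • Matrix.kroneckerMap (· * ·) (1 : Matrix (Finset (Orb (FermionTorus 2 L))) _ ℂ)
              (∑ b : GaugedHubbard.Bond L, Matrix.of fun k k' : GaugedHubbard.Bond L → Fin 2 × ZMod 4 => if k' = Function.update k b (k' b) then (if k b = k' b then (1 : ℂ) else 0) - 1 / 8 else 0)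
            + ((1 / g ^ 2 : ℝ) : ℂ) • Matrix.kroneckerMap (· * ·) (1 : Matrix (Finset (Orb (FermionTorus 2 L))) _ ℂ)
              (Matrix.diagonal fun k : GaugedHubbard.Bond L → Fin 2 × ZMod 4 => ∑ x : FermionTorus 2 L, (1 - (r (m (m (m (k (x, 0)) (k (x.shift 0, 1))) (iv (k (x.shift 1, 0)))) (iv (k (x, 1)))) 0 0
                + r (m (m (m (k (x, 0)) (k (x.shift 0, 1))) (iv (k (x.shift 1, 0)))) (iv (k (x, 1)))) 1 1) / 2));
        let P := ∑ b : GaugedHubbard.Bond L, (if b.2 = 0 then (1 : ℂ) else -1) • ∑ σ : Fin 2, ∑ τ : Fin 2, Matrix.kroneckerMap (· * ·) (annihilation (orb b.1 σ) * annihilation (orb (b.1.shift b.2) τ))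
            (Matrix.diagonal fun k : GaugedHubbard.Bond L → Fin 2 × ZMod 4 => if σ = 0 then r (k b) 1 τ else -r (k b) 0 τ);
        let p := fun ik : Finset (Orb (FermionTorus 2 L)) × (GaugedHubbard.Bond L → Fin 2 × ZMod 4) => ik.1.card = 2 * ⌊(1 - δ) * (L : ℝ) ^ 2 / 2⌋₊;
        ∀ ψ : {ik // p ik} → ℂ, 
          (ψ ≠ 0 ∧ ∃ E : ℝ, H.toBlock p p *ᵥ ψ = (E : ℂ) • ψ ∧ ∀ φ : {ik // p ik} → ℂ, E * (star φ ⬝ᵥ φ).re ≤ (star φ ⬝ᵥ H.toBlock p p *ᵥ φ).re) →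
          c * (L : ℝ) ^ 4 * (star ψ ⬝ᵥ ψ).re ≤ (star ψ ⬝ᵥ (Pᴴ * P).toBlock p p *ᵥ ψ).re)

/-- `HalfLineOrder U δ` — ORDER ON EVERY CLOSED HALF-LINE OF REGULAR COUPLINGS: for every floor
`g₁ > 0` there are a constant `c₁ > 0` and a side `L₁` with `OrderAt U δ g c₁ L₁` for all `g ≥ g₁`
(constants may depend on the floor). The conclusion of stub 1 and the hypothesis of stub 2. -/
def HalfLineOrder (U δ : ℝ) : Prop :=
  ∀ g₁ : ℝ, 0 < g₁ → ∃ c₁ : ℝ, 0 < c₁ ∧ ∃ L₁ : ℕ, ∀ g : ℝ, g₁ ≤ g → OrderAt U δ g c₁ L₁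

/-- `CorridorOrderAt U δ` — CORRIDOR ORDER AT `(U, δ)`: one constant `c' > 0` and one side `L₁` serve
the whole corridor `g ∈ (0, g₀]` for some `g₀ > 0`. Verbatim the matrix of the route target
`SgCorridorOrder` at `(U, δ)` (`sgCorridorOrder_iff`). -/
def CorridorOrderAt (U δ : ℝ) : Prop :=
  ∃ g₀ : ℝ, 0 < g₀ ∧ ∃ c' : ℝ, 0 < c' ∧ ∃ L₁ : ℕ, ∀ g : ℝ, 0 < g → g ≤ g₀ → OrderAt U δ g c' L₁

/-! ### Stub signatures (`Sig.stub_*`: named copies of the two stub statements, so that the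
hypothesis heads of `SgCorridor_of` carry the stub names) -/

/-- STUB 1 signature — persistence of the anchor's order to every positive floor. -/
def Sig.stub_halfLinePersistence : Prop :=
  ∀ (U δ g₀ c : ℝ) (L₀ : ℕ), 0 < U → δ ∈ Set.Ioo (0 : ℝ) (1 / 2) → 0 < g₀ → 0 < c →
    (∀ g : ℝ, g₀ ≤ g → OrderAt U δ g c L₀) → HalfLineOrder U δ

/-- STUB 2 signature — the constants do not degenerate at the singular endpoint `g → 0⁺`. -/
def Sig.stub_zeroCouplingFloor : Prop :=
  ∀ (U δ : ℝ), 0 < U → δ ∈ Set.Ioo (0 : ℝ) (1 / 2) → HalfLineOrder U δ → CorridorOrderAt U δ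

/-! ### Registered stubs (the only `sorry`s of this file) -/

/-- **STUB 1 `stub_halfLinePersistence` — PERSISTENCE TO EVERY POSITIVE FLOOR** (the bet of the crux:
pair order acquired at strong gauge coupling is not lost at any regular coupling `g > 0`, in particular
not across the confinement–deconfinement crossing of the finite gauge group `Q8`). For all `U > 0`,
`δ ∈ (0,1/2)`, `g₀ > 0`, `c > 0`, `L₀`: the anchor matrix at `(U, δ)` (every-ground-state gauged `B1g`
pair order `≥ c L⁴‖ψ‖²` for all `g ≥ g₀`, even `L ≥ L₀` — verbatim the matrix of `SgAnchorOrder`)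
implies `HalfLineOrder U δ`. Strong side: Osterwalder–Seiler 1978 / Fradkin–Shenker 1979 continuity of
the confined regime (cluster expansion in `t/g²` and `g⁻⁴`, to be lifted to the pair two-point function
of block ground states); weak side: stability of the LOCAL gauge-invariant singlet pair order through
the `Q8` quantum-double transition (Kitaev 2003; Bravyi–Hastings–Michalakis 2010 for the gauge
sector). Not claimed provable now — crux-sized residual; the model-free shape is false
(`TwTipContinuation.Negative.not_abstractTipShape`), so any proof uses the structure of `H_g`. Why it
might fail: deconfinement at small `g` in 2+1 D returns spinful quasiparticles and spin competitors;
order may vanish on a window or jump at a first-order transition (Borla et al. 2022, Gazit et al.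
2017, Assaad–Grover 2016). doi:10.1103/physrevd.19.3682, doi:10.1016/0003-4916(78)90039-8,
doi:10.1103/physrevb.105.075132, doi:10.1038/nphys4028, doi:10.1103/physrevx.6.041049. -/
theorem stub_halfLinePersistence :
    ∀ (U δ g₀ c : ℝ) (L₀ : ℕ), 0 < U → δ ∈ Set.Ioo (0 : ℝ) (1 / 2) → 0 < g₀ → 0 < c →
      (∀ g : ℝ, g₀ ≤ g → OrderAt U δ g c L₀) → HalfLineOrder U δ := by
  sorry

/-- **STUB 2 `stub_zeroCouplingFloor` — A FLOOR FOR `c′` AT THE SINGULAR ENDPOINT `g → 0⁺`.** For all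
`U > 0`, `δ ∈ (0,1/2)`: `HalfLineOrder U δ` (order on every `[g₁, ∞)` with floor-dependent constants)
implies `CorridorOrderAt U δ` (one constant `c′ > 0` and one side `L₁` on a whole corridor `(0, g₀′]`,
verbatim the matrix of `SgCorridorOrder` at `(U, δ)`): `inf_{(0,g₀′]} c(g) > 0`, `sup L(g) < ∞`.
Mechanism: Born–Oppenheimer/degenerate-perturbation reduction as `g → 0⁺` — the magnetic weight has
gap `≥ g⁻²` above the flat `Q8` connections (finite group: flatness is an equation), block ground
states concentrate on fermions ⊗ flat links up to `O(g²)`, and the reduced problem is a finite direct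
sum of `Q8`-spin-twisted Hubbard tori mixed at order `g²` by the electric term (Kato 1966 II-§2;
Datta–Fernández–Fröhlich 1996); `c(g)` is then controlled at `0⁺` by the order of the SELECTED reduced
ground states. Why it might fail: order at every `g > 0` generated by the gauge fluctuations themselves
with `c(g) → 0` (an `O(g²)` mediated spin interaction) where the reduced twisted-Hubbard ground states
carry no `B1g` order; or `L(g) → ∞` because the reduction needs `g⁻²` above an `L`-dependent density of
fermionic states. Size: L. doi:10.1016/S0003-4916(02)00018-0, doi:10.1063/1.3490195,
doi:10.1007/BF02179651, doi:10.1103/physrevd.11.395. -/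
theorem stub_zeroCouplingFloor :
    ∀ (U δ : ℝ), 0 < U → δ ∈ Set.Ioo (0 : ℝ) (1 / 2) → HalfLineOrder U δ → CorridorOrderAt U δ := by
  sorry

/-! ### Bookkeeping (proved): the route items ARE the prefixed `OrderAt` statements -/

/-- The anchor crux unfolds to "`OrderAt` on a half-line `[g₀, ∞)` at some `(U, δ)` with one constant".
[bookkeeping] -/
theorem sgAnchorOrder_iff :
    SgAnchorOrder ↔ ∃ U : ℝ, 0 < U ∧ ∃ δ ∈ Set.Ioo (0 : ℝ) (1 / 2), ∃ g₀ : ℝ, 0 < g₀ ∧ ∃ c : ℝ,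
      0 < c ∧ ∃ L₀ : ℕ, ∀ g : ℝ, g₀ ≤ g → OrderAt U δ g c L₀ :=
  Iff.rfl

/-- The route target unfolds to "`CorridorOrderAt` at some `(U, δ)`". [bookkeeping] -/
theorem sgCorridorOrder_iff :
    SgCorridorOrder ↔ ∃ U : ℝ, 0 < U ∧ ∃ δ ∈ Set.Ioo (0 : ℝ) (1 / 2), CorridorOrderAt U δ :=
  Iff.rfl

/-! ### Composition -/

/-- **The two pieces give the corridor transfer at the anchor's own `(U, δ)`** (pure logic): take the
anchor witness `(U, δ, g₀, c, L₀)`; stub 1 gives order on every half-line at `(U, δ)`; stub 2 floors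
the constants on a corridor `(0, g₀′]`; repackage as the route target with the same `(U, δ)`. -/
theorem corridorOrder_of_pieces (h₁ : Sig.stub_halfLinePersistence) (h₂ : Sig.stub_zeroCouplingFloor)
    (hA : SgAnchorOrder) : SgCorridorOrder := by
  obtain ⟨U, hU, δ, hδ, g₀, hg₀, c, hc, L₀, hord⟩ := sgAnchorOrder_iff.1 hA
  exact sgCorridorOrder_iff.2 ⟨U, hU, δ, hδ, h₂ U δ hU hδ (h₁ U δ g₀ c L₀ hU hδ hg₀ hc hord)⟩

/-- **`SgCorridor` from the two stubs, read with the stubs abstracted** (the pure-logic implication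
`stub₁-sig → stub₂-sig → SgCorridor`; hypothesis heads `Sig.stub_*` carry the registered stub names;
conclusion = the route decl BY NAME). [folklore] -/
theorem SgCorridor_of :
    Sig.stub_halfLinePersistence → Sig.stub_zeroCouplingFloor → SgCorridor :=
  fun h₁ h₂ => show SgAnchorOrder → SgCorridorOrder from corridorOrder_of_pieces h₁ h₂

/-- **The skeleton in its final A12 shape**: the crux BY NAME from the two registered stubs; it becomes
the crux proof when the last `stub_*` is discharged (until then it depends on `sorryAx` through the
stubs only — no `sorry` of its own). -/
theorem SgCorridor_proof : SgCorridor :=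
  SgCorridor_of stub_halfLinePersistence stub_zeroCouplingFloor

end Summit.HubbardSuperconductivity.HubbardSuperconductivity.Cruxes.SgCorridor.Birth

end
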